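import Summits.NavierStokesRegularity.NavierStokesRegularity.Theorems.WakeRatchetTailRatchetDSSVisc
import Summits.NavierStokesRegularity.NavierStokesRegularity.Theorems.WakeRatchetBlockRatioLeOne

/-!
# Crux `WakeRatchet.EternalInviscidRate` (⟨stmt-NavierStokesRegularity-25646⟩, K1⁰ RATE) READ ON THE SELF-SIMILAR STRATUM:
# the crux BY NAME pins every fixed-spread admissible DSS front below the rate line `dssMu ≤ (1+ε₀)^{−a}`, `a = a(R) > 1`,
# hence implies the tree's K1 predicate `NoSurvivingDSS R 1`; kill criterion: (S₁)-surviving persistent DSS fronts refute it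

For an admissible discretely self-similar blow-up wave (`IsDSSWave ε₀ α π T Φ`, ANY finite profile family, ANY shape permutation `π`, delay
`T`) of a cancelling table, the embedded eternal solution `dssEmbed π T Φ r` is uniformly bounded, admissible, and BLOCK-self-similar with
period `orderOf π` and lag `orderOf π · T` (tree: `IsDSSWave.isEternal_dssEmbed`, `uniformBound_dssEmbed`, `WakeRatchetDSS.dssEmbed_shift`),
with block ratio `dssMu^{orderOf π}` (`WakeRatchetDSS.blockRatio_orderOf_eq_pow`).  A rate-`a` tail contraction along it forces the block ratio
`≤ ((1+ε₀)^{−a})^{orderOf π}` (`WakeRatchetDSS.blockRatio_le_of_rateContraction`).  Hence: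
* `dssMu_le_of_rateContraction` — rate-`a` contraction along the embedded solution of a non-trivial DSS wave ⇒ `dssMu ε₀ T ≤ (1+ε₀)^{−a}`.
* `dssMu_le_of_eternalInviscidRate` — **the crux BY NAME ⇒** for every `R ≥ 1` there are `a > 1`, `εs > 0` with: every non-trivial admissible
  DSS wave of every `E₂(R)` table at scale ratio `ε₀ ≤ εs` has per-shell retention `dssMu ε₀ T ≤ (1+ε₀)^{−a}` — in blow-up-exponent currency
  (`dssMu = λ^{−5y}`), EVERY fixed-spread self-similar front has `y ≥ a/5 > 1/5` (K41: `y = 1/3`; the dissipation line is `y = 1/5`).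
* `noSurvivingDSS_of_eternalInviscidRate` — **the crux BY NAME ⇒ `NoSurvivingDSS R a'` for every `R ≥ 1` and every `a' < a(R)`, in particular
  `NoSurvivingDSS R 1`** (the tree's K1 Liouville predicate, `SelfSimilarCascadeBlowup`): the per-shell rate crux of the conveyor line already
  carries the K1-content that the aside crux `TailRatchet` was shown to carry (`noSurvivingDSS_of_tailRatchet`), with no uniform wake fraction.
* `EternalInviscidRate_false_of_survivingDSSWaves` — KILL CRITERION (contrapositive): non-trivial admissible DSS waves with `(1+ε₀)^{−1} ≤ dssMu`
  ((S₁)-surviving or unitary-side) on some fixed `E₂(R)` at arbitrarily small scale ratios refute the crux; equivalently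
  `(∃ R ≥ 1, ¬ NoSurvivingDSS R 1) → ¬ EternalInviscidRate` (`EternalInviscidRate_false_of_not_noSurvivingDSS`).
READING (census).  This is the inviscid companion of the landed `EternalViscousRate_false_of_ViscousBlockDSSWaves` (⟨25647⟩): there the covariant
viscosity PINS the block ratio to the `a = 1` line, so bare existence kills; here nothing pins the ratio, so the hypothesis must carry the rate
(`dssMu ≥ (1+ε₀)^{−1}`, i.e. front exponent `y ≤ 1/5`).  No such front is constructed or known at fixed spread (dyadic numerics: `1 − dssMu ≈ 1.66ε₀`,
`y ≈ 0.33`); Tao's complete-transfer circuit needs `ε₀ ≫ R^{−1/2}` and is outside the crux's window `ε₀ ≤ εs(R)`.  No verdict changes.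
MODEL lattice only (Tao 2016 §4 renormalised cascade); nothing here is a statement about the Navier–Stokes equations; no registered stub of
skeleton d183ebc2 is closed; no summit is proved or refuted by this file.
[cite: Tao2016AveragedNS, §4 Lemma 4.1 (4.8)–(4.10) with the cancellation (4.3), Thm. 4.2 (statement shape), §6.4]
-/

noncomputable section

set_option linter.dupNamespace false

namespace Summit.NavierStokesRegularity.NavierStokesRegularity.Theorems

namespace WakeRatchetDSS

open Filter Topology
open Literature.Analysis.FluidPDE Literature.Analysis.FluidPDE.TaoCascade

/-- **Rate contraction pins the retention of a DSS front.**  If a non-trivial admissible DSS wave of a cancelling table (`ε₀ > 0`) carries,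
along its embedded eternal solution `dssEmbed π T Φ r`, the rate-`a` tail contraction «tail above `n` bounded by `M` at all log-times ⇒ tail
above `n+1` bounded by `(1+ε₀)^{−a}M` at all log-times» for every shell, then `dssMu ε₀ T ≤ (1+ε₀)^{−a}`.  MODEL lattice only.
[cite: Tao2016AveragedNS, §4 Lemma 4.1 (4.8)–(4.10), (4.3), §6.4] -/
theorem dssMu_le_of_rateContraction {ε₀ : ℝ} (hε : 0 < ε₀) {ρ : Type*} [Fintype ρ]
    {α : Fin 4 → Fin 4 → Fin 4 → ℤ × ℤ × ℤ → ℝ} (hc : IsCancellingCoeff α)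
    {π : Equiv.Perm ρ} {T : ℝ} {Φ : ρ → ℝ → Em 4} (h : IsDSSWave ε₀ α π T Φ) {r : ρ} {x : ℝ} (hne : Φ r x ≠ 0)
    {a : ℝ}
    (hRate : ∀ (n : ℤ) (M : ℝ), (∀ σ : ℝ, ∑' k : ℕ, physEnergy ε₀ (dssEmbed π T Φ r) (n + k) σ ≤ M) →
      ∀ σ : ℝ, ∑' k : ℕ, physEnergy ε₀ (dssEmbed π T Φ r) (n + 1 + k) σ ≤ (1 + ε₀) ^ (-a) * M) :
    dssMu ε₀ T ≤ (1 + ε₀) ^ (-a) := by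
  have hp : 0 < orderOf π := orderOf_pos π
  have hW : IsEternal ε₀ α (dssEmbed π T Φ r) := h.isEternal_dssEmbed r
  have hU : UniformBound (dssEmbed π T Φ r) := uniformBound_dssEmbed h r
  have hne' : dssEmbed π T Φ r 0 x ≠ 0 := by simpa [dssEmbed] using hne
  have hle := blockRatio_le_of_rateContraction hε hc hW.isEternalVisc hU (T := orderOf π * T)
    (dssEmbed_shift π T Φ r) hRate hne'
  rw [blockRatio_orderOf_eq_pow hε.le] at hle
  -- `μ^p ≤ q^p` with `μ, q ≥ 0`, `p ≥ 1` ⇒ `μ ≤ q`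
  have hμ0 : 0 ≤ dssMu ε₀ T := (dssMu_pos T (by linarith)).le
  have hq0 : 0 ≤ (1 + ε₀) ^ (-a) := Real.rpow_nonneg (by linarith) _
  exact (pow_le_pow_iff_left₀ hμ0 hq0 hp.ne').1 hle

/-- **The crux BY NAME pins every fixed-spread self-similar front below the rate line.**  `WakeRatchet.EternalInviscidRate` implies: for every
`R ≥ 1` there are `a > 1` and `εs > 0` such that for all `0 < ε₀ ≤ εs`, every table of `E₂(R)` and every non-trivial admissible DSS wave on it
(any finite profile family, any shape permutation, any delay `T`), `dssMu ε₀ T ≤ (1+ε₀)^{−a}` (front exponent `y ≥ a/5 > 1/5`).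
MODEL lattice only.  [cite: Tao2016AveragedNS, §4 Lemma 4.1 (4.8)–(4.10), (4.3), Thm. 4.2 (statement shape), §6.4] -/
theorem dssMu_le_of_eternalInviscidRate
    (hK : Summit.NavierStokesRegularity.NavierStokesRegularity.Theses.WakeRatchet.EternalInviscidRate)
    {R : ℝ} (hR : 1 ≤ R) :
    ∃ a : ℝ, 1 < a ∧ ∃ εs : ℝ, 0 < εs ∧ ∀ ε₀ : ℝ, 0 < ε₀ → ε₀ ≤ εs →
      ∀ α : Fin 4 → Fin 4 → Fin 4 → ℤ × ℤ × ℤ → ℝ, InTableClass R α →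
      ∀ (q : ℕ) (π : Equiv.Perm (Fin q)) (T : ℝ) (Φ : Fin q → ℝ → Em 4),
        IsDSSWave ε₀ α π T Φ → (∃ r x, Φ r x ≠ 0) → dssMu ε₀ T ≤ (1 + ε₀) ^ (-a) := by
  obtain ⟨a, ha, εs, hεs, H⟩ := hK R hR
  refine ⟨a, ha, εs, hεs, fun ε₀ hε₀ hle α hα q π T Φ hW hne => ?_⟩
  obtain ⟨r, x, hne⟩ := hne
  exact dssMu_le_of_rateContraction hε₀ hα.2.1 hW hne
    (H ε₀ hε₀ hle α hα (dssEmbed π T Φ r) (hW.isEternal_dssEmbed r) (uniformBound_dssEmbed hW r))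

/-- **The crux BY NAME ⇒ the tree's K1 predicate, with a margin.**  `WakeRatchet.EternalInviscidRate` implies `NoSurvivingDSS R a'` for every
`R ≥ 1` and every exponent `a' < a(R)` (the crux's rate at spread `R`): no `E₂(R)` table below `εs(R)` carries a non-trivial admissible
(S_{a'})-surviving DSS wave.  MODEL lattice only.  [cite: Tao2016AveragedNS, §4 Thm. 4.2 (statement shape), §6.4] -/
theorem noSurvivingDSS_of_eternalInviscidRate_margin
    (hK : Summit.NavierStokesRegularity.NavierStokesRegularity.Theses.WakeRatchet.EternalInviscidRate)
    {R : ℝ} (hR : 1 ≤ R) :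
    ∃ a : ℝ, 1 < a ∧ ∀ a' : ℝ, a' < a → NoSurvivingDSS R a' := by
  obtain ⟨a, ha, εs, hεs, H⟩ := dssMu_le_of_eternalInviscidRate hK hR
  refine ⟨a, ha, fun a' ha' => ⟨εs, hεs, fun ε₀ hε₀ hle α hα q π T Φ hW hS r x => ?_⟩⟩
  by_contra hne
  have hμ := H ε₀ hε₀ hle α hα q π T Φ hW ⟨r, x, hne⟩
  -- `(1+ε₀)^{-a'} ≤ μ ≤ (1+ε₀)^{-a}` contradicts `-a < -a'`
  have h1 : 1 < 1 + ε₀ := by linarith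
  have hlt : (1 + ε₀) ^ (-a) < (1 + ε₀) ^ (-a') := Real.rpow_lt_rpow_of_exponent_lt h1 (by linarith)
  exact absurd (hS.1.trans hμ) (not_le.mpr hlt)

/-- **The crux BY NAME ⇒ `NoSurvivingDSS R 1` for every `R ≥ 1`** (the K1 Liouville predicate at the dissipation line: no fixed-spread table
below `εs(R)` carries a non-trivial admissible DSS front with `(1+ε₀)^{−1} ≤ dssMu < 1`).  MODEL lattice only.
[cite: Tao2016AveragedNS, §4 Thm. 4.2 (statement shape), §6.4] -/
theorem noSurvivingDSS_of_eternalInviscidRate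
    (hK : Summit.NavierStokesRegularity.NavierStokesRegularity.Theses.WakeRatchet.EternalInviscidRate)
    {R : ℝ} (hR : 1 ≤ R) : NoSurvivingDSS R 1 := by
  obtain ⟨a, ha, H⟩ := noSurvivingDSS_of_eternalInviscidRate_margin hK hR
  exact H 1 ha

/-- **Kill criterion for ⟨25646⟩ (contrapositive).**  Non-trivial admissible DSS waves with per-shell retention AT OR ABOVE the dissipation
line, `(1+ε₀)^{−1} ≤ dssMu ε₀ T`, on the tables of ONE fixed class `E₂(R)` at arbitrarily small scale ratios refute `WakeRatchet.EternalInviscidRate`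
(front exponent `y ≤ 1/5` somewhere in the class).  The existence hypothesis is NOT supplied by the tree (no fixed-spread front is constructed);
no verdict changes.  MODEL lattice only.  [cite: Tao2016AveragedNS, §4 Thm. 4.2 (statement shape), §6.4] -/
theorem EternalInviscidRate_false_of_survivingDSSWaves {R : ℝ} (hR : 1 ≤ R)
    (hF : ∀ ε : ℝ, 0 < ε → ∃ ε₀ : ℝ, 0 < ε₀ ∧ ε₀ ≤ ε ∧
      ∃ α : Fin 4 → Fin 4 → Fin 4 → ℤ × ℤ × ℤ → ℝ, InTableClass R α ∧
        ∃ (q : ℕ) (π : Equiv.Perm (Fin q)) (T : ℝ) (Φ : Fin q → ℝ → Em 4),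
          IsDSSWave ε₀ α π T Φ ∧ (1 + ε₀) ^ (-(1 : ℝ)) ≤ dssMu ε₀ T ∧ ∃ r x, Φ r x ≠ 0) :
    ¬ Summit.NavierStokesRegularity.NavierStokesRegularity.Theses.WakeRatchet.EternalInviscidRate := by
  intro hK
  obtain ⟨a, ha, εs, hεs, H⟩ := dssMu_le_of_eternalInviscidRate hK hR
  obtain ⟨ε₀, hε₀, hle, α, hα, q, π, T, Φ, hW, hS, hne⟩ := hF εs hεs
  have hμ := H ε₀ hε₀ hle α hα q π T Φ hW hne
  have h1 : 1 < 1 + ε₀ := by linarith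
  have hlt : (1 + ε₀) ^ (-a) < (1 + ε₀) ^ (-(1 : ℝ)) := Real.rpow_lt_rpow_of_exponent_lt h1 (by linarith)
  exact absurd (hS.trans hμ) (not_le.mpr hlt)

/-- **Kill criterion in the tree's K1 vocabulary.**  If for some `R ≥ 1` the Liouville predicate `NoSurvivingDSS R 1` FAILS, the crux
`WakeRatchet.EternalInviscidRate` is false.  MODEL lattice only.  [cite: Tao2016AveragedNS, §4 Thm. 4.2 (statement shape), §6.4] -/
theorem EternalInviscidRate_false_of_not_noSurvivingDSS
    (h : ∃ R : ℝ, 1 ≤ R ∧ ¬ NoSurvivingDSS R 1) :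
    ¬ Summit.NavierStokesRegularity.NavierStokesRegularity.Theses.WakeRatchet.EternalInviscidRate := by
  obtain ⟨R, hR, hN⟩ := h
  exact fun hK => hN (noSurvivingDSS_of_eternalInviscidRate hK hR)

end WakeRatchetDSS

end Summit.NavierStokesRegularity.NavierStokesRegularity.Theorems

end
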